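import Summits.BirchSwinnertonDyer.BirchSwinnertonDyer.Theses.UniversalToricDescent
import Summits.BirchSwinnertonDyer.BirchSwinnertonDyer.Theorems.UniversalToricDescentAcDualMuZeroCriterion
import Literature.NumberTheory.EllipticCurves.KummerSelmerStructure
import Literature.NumberTheory.EllipticCurves.Selmer

/-!
# Sketch — crux ideas on `UniversalToricDescent.TwinAlgMuZeroAtThree` (stmt-BirchSwinnertonDyer-24254)
planner bsd-wall-utd-idea g52. First lemmas of the two ideas `residual-layer-criterion` and
`inert-beilinson-flach-road` (cards `idea-residual-layer-criterion.md`, `idea-inert-beilinson-flach-road.md`):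
`def … : Prop` statements typed over tree declarations, plus two small kernel-checked pieces
(`conclusion_of_selmerAc_eq_bot`, `inert_decontamination_unit`). BSD is not advanced by this file.
-/

set_option autoImplicit false
set_option linter.dupNamespace false

noncomputable section

open scoped Classical

/-! ## Idea B — `residual-layer-criterion` -/

namespace Summit.BirchSwinnertonDyer.BirchSwinnertonDyer.Cruxes.TwinAlgMuZeroAtThree.ResidualLayerCriterion

open NumberField IsDedekindDomain Field
open Literature.NumberTheory.EllipticCurves Literature.NumberTheory.EllipticCurves.GreenbergSelmer
  Literature.NumberTheory.GaloisRepresentations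
open Summit.BirchSwinnertonDyer.Rank1Residual.X11b Summit.BirchSwinnertonDyer.Rank1Residual.X11b.AcSelmer
open Summit.BirchSwinnertonDyer.BirchSwinnertonDyer.Theorems.UniversalToricDescentAcDualMuZero

universe u

/-- **B1 (kernel-checked endgame).** If Castella's anticyclotomic Selmer group `Sel_𝔭^∅(K_∞, E[p^∞])`
VANISHES, the conclusion shape of `TwinAlgMuZeroAtThree` holds for its dual `X` (torsion, and
`Ch·R₀⟦T⟧ = (g)` with a norm-one coefficient) — via the tree's
`isTorsion_and_exists_generator_of_finite_pTorsion`. -/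
theorem conclusion_of_selmerAc_eq_bot {K : Type} [Field K] [NumberField K] (W : WeierstrassCurve K)
    [W.IsElliptic] (p : ℕ) [Fact p.Prime] (κ : ZpExtension K p) (𝔭 : HeightOneSpectrum (𝓞 K))
    (γ : absoluteGaloisGroup K) [Fact (κ.IsTopGenerator γ)]
    (h : selmerAc W p κ 𝔭 ∅ = ⊥) :
    Module.IsTorsion (IwasawaAlgebra p) (XAc W p κ 𝔭 ∅ γ) ∧
      ∃ g : UnrSeries p,
        (XAc.charIdeal W p κ 𝔭 ∅ γ).map (PowerSeries.map (Halves.toUnr p)) = Ideal.span {g} ∧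
          ∃ i : ℕ, ‖((PowerSeries.coeff i g : unrIntegers p) : ℂ_[p])‖ = 1 := by
  refine isTorsion_and_exists_generator_of_finite_pTorsion W p κ 𝔭 ∅ γ Set.finite_empty ?_
  have hsub : Subsingleton (selmerAc W p κ 𝔭 ∅) := by
    rw [h]
    infer_instance
  exact Set.toFinite _

/-- **B2 = rung schema `(R₀)` (base layer, no `L`-function, no Kolyvagin system).** For the twin
`E′ = W′` in buckets B/C and a Heegner-type `K` with `3 = 𝔭𝔭′`: if `E′(ℚ₃)[3] = 0` (non-anomalous;
automatic in C and in B under the route's guard `3 ∤ v₃(Δ′)`), `E′(K_v)[3] = 0` at every `v ∣ N′`,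
`Sel₃(E′/K) ≅ ℤ/3`, and SOME Selmer class has non-zero localisation at `𝔭`, then
`Sel_{𝔭′}(K_∞, E′[3^∞]) = 0` (Castella's group: strict at `𝔭′`, relaxed at `𝔭`, `Σ = ∅`). Mechanism:
Poitou–Tate at layer `0` gives `Sel_{rel 𝔭, str 𝔭′}(K, E′[3]) = 0`; exact residual control
(`H⁰(K_∞, E′[3]) = 0`, local non-anomaly at `𝔭′`) gives `Sel_{rel,str}(K_∞, E′[3])^Γ = 0`, hence `= 0`;
and `Sel_{𝔭′}(K_∞, E′[3^∞])[3] ↪ Sel_{rel,str}(K_∞, E′[3])`. -/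
def BaseLayerResidualVanishing : Prop :=
  ∀ (W' : WeierstrassCurve ℚ) [W'.IsElliptic] (N' : ℕ) [NeZero N'] (K : Type) [Field K] [NumberField K]
    (κ : ZpExtension K 3), κ.IsAnticyclotomic → IsImaginaryQuadratic K →
    W'.HasSurjectiveModNGaloisRep 3 → W'.conductorNorm ℤ = N' →
    ∀ (𝔭 𝔭' : HeightOneSpectrum (𝓞 K)), ((3 : ℕ) : 𝓞 K) ∈ 𝔭.asIdeal →
      ((3 : ℕ) : 𝓞 K) ∈ 𝔭'.asIdeal → 𝔭' ≠ 𝔭 →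
    -- (h2) non-anomalous at `3`: `E′(ℚ₃)[3] = 0`
    (∀ P : (W'.baseChange ℚ_[3]).toAffine.Point, (3 : ℕ) • P = 0 → P = 0) →
    -- (h3) no rational `3`-torsion locally at the bad primes of `E′` over `K`
    (∀ v : HeightOneSpectrum (𝓞 K), ((N' : ℕ) : 𝓞 K) ∈ v.asIdeal →
      ∀ P : ((W'.baseChange K).baseChange (v.adicCompletion K)).toAffine.Point,
        (3 : ℕ) • P = 0 → P = 0) →
    -- (h4) `Sel₃(E′/K)` is one-dimensional
    Nat.card (WeierstrassCurve.selmerGroup (W'.baseChange K) 3) = 3 →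
    -- (h5) some Selmer class is not locally divisible by `3` at `𝔭`
    (∃ c ∈ WeierstrassCurve.selmerGroup (W'.baseChange K) 3,
      galoisCohomology.localization ((W'.baseChange K).torsionGaloisModule 3)
        (Sum.inr 𝔭 : Place K) 1 c ≠ 0) →
    selmerAc (W'.baseChange K) 3 κ 𝔭' ∅ = ⊥

/-- **B3 (pure `Ω = 𝔽₃⟦T⟧`-algebra; the layer criterion).** A finitely generated `𝔽₃⟦T⟧`-module `X`
with `#(X / T^{3^n} X) < 3^{3^n}` for SOME `n` is finite (its free rank is `0`). Applied to
`X = Sel_{rel,str}(K_∞, E′[3])^∨` with `X/T^{3^n}X = Sel_{rel,str}(K_n, E′[3])^∨` (exact residual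
control: `ω_n = (1+T)^{3^n} − 1 = T^{3^n}` in characteristic `3`), this is the one-layer criterion
`dim_{𝔽₃} Sel_{rel 𝔭, str 𝔭′}(K_n, E′[3]) < 3^n for some n ⟹ μ(X_{∅,0}(E′/K_∞)) = 0 ∧ torsion`. -/
def OmegaLayerCriterion : Prop :=
  ∀ (X : Type) [AddCommGroup X] [Module (PowerSeries (ZMod 3)) X] [Module.Finite (PowerSeries (ZMod 3)) X]
    (n : ℕ),
    Nat.card (X ⧸ (Ideal.span {(PowerSeries.X ^ (3 ^ n) : PowerSeries (ZMod 3))} •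
        (⊤ : Submodule (PowerSeries (ZMod 3)) X))) < 3 ^ (3 ^ n) →
    Finite X

/-- **B4 (the rung road, composition).** `(R₀)` instances close `TwinAlgMuZeroAtThree` at those
`(E′, K, 𝔭′)` — by `conclusion_of_selmerAc_eq_bot`. Stated as the implication actually used. -/
def RungRoad : Prop :=
  BaseLayerResidualVanishing →
  ∀ (W' : WeierstrassCurve ℚ) [W'.IsElliptic] (N' : ℕ) [NeZero N'] (K : Type) [Field K] [NumberField K]
    (κ : ZpExtension K 3), κ.IsAnticyclotomic → IsImaginaryQuadratic K →
    W'.HasSurjectiveModNGaloisRep 3 → W'.conductorNorm ℤ = N' →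
    ∀ (γ : absoluteGaloisGroup K) [Fact (κ.IsTopGenerator γ)]
      (𝔭 𝔭' : HeightOneSpectrum (𝓞 K)), ((3 : ℕ) : 𝓞 K) ∈ 𝔭.asIdeal →
      ((3 : ℕ) : 𝓞 K) ∈ 𝔭'.asIdeal → 𝔭' ≠ 𝔭 →
    (∀ P : (W'.baseChange ℚ_[3]).toAffine.Point, (3 : ℕ) • P = 0 → P = 0) →
    (∀ v : HeightOneSpectrum (𝓞 K), ((N' : ℕ) : 𝓞 K) ∈ v.asIdeal →
      ∀ P : ((W'.baseChange K).baseChange (v.adicCompletion K)).toAffine.Point,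
        (3 : ℕ) • P = 0 → P = 0) →
    Nat.card (WeierstrassCurve.selmerGroup (W'.baseChange K) 3) = 3 →
    (∃ c ∈ WeierstrassCurve.selmerGroup (W'.baseChange K) 3,
      galoisCohomology.localization ((W'.baseChange K).torsionGaloisModule 3)
        (Sum.inr 𝔭 : Place K) 1 c ≠ 0) →
    Module.IsTorsion (IwasawaAlgebra 3) (XAc ((W'.baseChange K)) 3 κ 𝔭' ∅ γ) ∧
      ∃ g' : UnrSeries 3,
        (XAc.charIdeal (W'.baseChange K) 3 κ 𝔭' ∅ γ).map (PowerSeries.map (Halves.toUnr 3)) =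
            Ideal.span {g'} ∧
          ∃ i : ℕ, ‖((PowerSeries.coeff i g' : unrIntegers 3) : ℂ_[3])‖ = 1

/-- `RungRoad` holds outright (the composition is `conclusion_of_selmerAc_eq_bot`). -/
theorem rungRoad_holds : RungRoad := by
  intro hR W' _ N' _ K _ _ κ hκ hK hρ hN γ _ 𝔭 𝔭' h𝔭 h𝔭' hne h2 h3 h4 h5
  haveI : (W'.baseChange K).IsElliptic := by infer_instance
  exact conclusion_of_selmerAc_eq_bot (W'.baseChange K) 3 κ 𝔭' γ
    (hR W' N' K κ hκ hK hρ hN 𝔭 𝔭' h𝔭 h𝔭' hne h2 h3 h4 h5)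

end Summit.BirchSwinnertonDyer.BirchSwinnertonDyer.Cruxes.TwinAlgMuZeroAtThree.ResidualLayerCriterion

/-! ## Idea A — `inert-beilinson-flach-road` -/

namespace Summit.BirchSwinnertonDyer.BirchSwinnertonDyer.Cruxes.TwinAlgMuZeroAtThree.InertBeilinsonFlach

open Literature.NumberTheory.EllipticCurves
open Summit.BirchSwinnertonDyer.Rank1Residual.X11b Summit.BirchSwinnertonDyer.Rank1Residual.X11b.AcSelmer

/-- **A1 (the lever computes).** The Beilinson–Flach decontamination factor specialised on the
anticyclotomic line of the twin is `c² − ε_K(c)·c^w` (`[c] ↦ 1` on ring-class towers, `ε_f = ε_ψ = 1`);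
for `c ≡ 1 (mod 3)` INERT in `K` (`ε_K(c) = −1`) it is `c² + c^w ≡ 2 (mod 3)`, a `3`-adic unit for
every weight exponent `w` — whereas for split `c` (`ε_K(c) = +1`, the choice forced by
`c ≡ 1 (mod N_f N_ψ)` in LLZ15 §5.3) it is `c² − c^w ≡ 0 (mod 3)`. -/
theorem inert_decontamination_unit (c w : ℕ) (hc : c % 3 = 1) : (c ^ 2 + c ^ w) % 3 = 2 := by
  have h1 : c ^ 2 % 3 = 1 := by rw [Nat.pow_mod, hc]
  have h2 : c ^ w % 3 = 1 := by rw [Nat.pow_mod, hc]; simp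
  omega

/-- The split choice never works at `3`: `c² − c^w ≡ 0 (mod 3)` for `3 ∤ c`, `w` even. -/
theorem split_decontamination_not_unit (c w : ℕ) (hc : c % 3 ≠ 0) (hw : Even w) :
    (c ^ 2) % 3 = (c ^ w) % 3 := by
  obtain ⟨k, rfl⟩ := hw
  have hc' : c % 3 = 1 ∨ c % 3 = 2 := by omega
  have hsq : c ^ 2 % 3 = 1 := by
    rcases hc' with h | h <;> simp [Nat.pow_mod, h]
  rw [hsq, ← two_mul, pow_mul, Nat.pow_mod, hsq]
  simp

/-- **A2 (`Λ`-algebra endgame of the Euler-system road).** If `X` is a finitely generated torsion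
`Λ = ℤ₃⟦T⟧`-module and its characteristic ideal, pushed to `R₀⟦T⟧`, CONTAINS a power series `F` with a
norm-one coefficient (an Euler-system divisibility `char X ∣ F` by an `F` with `μ(F) = 0`), then
`Ch·R₀⟦T⟧ = (g)` for some `g` with a norm-one coefficient (`μ(X) = 0`). -/
def IntegralInclusionGivesUnitGenerator : Prop :=
  ∀ (X : Type) [AddCommGroup X] [Module (IwasawaAlgebra 3) X] [Module.Finite (IwasawaAlgebra 3) X],
    Module.IsTorsion (IwasawaAlgebra 3) X →
    (∃ F : UnrSeries 3,
      F ∈ (Module.charIdeal (IwasawaAlgebra 3) X).map (PowerSeries.map (Halves.toUnr 3)) ∧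
        ∃ i : ℕ, ‖((PowerSeries.coeff i F : unrIntegers 3) : ℂ_[3])‖ = 1) →
    ∃ g : UnrSeries 3,
      (Module.charIdeal (IwasawaAlgebra 3) X).map (PowerSeries.map (Halves.toUnr 3)) = Ideal.span {g} ∧
        ∃ i : ℕ, ‖((PowerSeries.coeff i g : unrIntegers 3) : ℂ_[3])‖ = 1

end Summit.BirchSwinnertonDyer.BirchSwinnertonDyer.Cruxes.TwinAlgMuZeroAtThree.InertBeilinsonFlach

end
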